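import Mathlib.RingTheory.OrderOfVanishing.Noetherian
import Mathlib.LinearAlgebra.Matrix.Transvection
import Mathlib.LinearAlgebra.Quotient.Pi
import Mathlib.RingTheory.Localization.Integer
import Mathlib.Algebra.BigOperators.WithTop
import Mathlib.LinearAlgebra.FreeModule.Finite.Basic
import HarnessLib

/-!
# Lengths and determinants: `ℓ_A(Aⁿ / P Aⁿ) = ord_A(det P)` (Fulton, Lemma A.2.6)

For a Noetherian domain `A` of Krull dimension `≤ 1` and a square matrix `P` over `A` with
`det P ≠ 0`, the cokernel of `P : Aⁿ → Aⁿ` has finite length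
`ℓ_A(Aⁿ / P Aⁿ) = ord_A(det P) := ℓ_A(A / det(P) A)` (Mathlib `Ring.ord`, Stacks Tag 02MD).
This is Fulton, *Intersection Theory*, Lemma A.2.6 (in the case "A a one-dimensional domain – the
only case needed in the book"), equivalently Stacks, Algebra, Lemma 10.121.7 (Tag 02MI) for the
lattice `Aⁿ ⊂ Kⁿ`; it is the key to `ord_A(Nm f) = Σ [κ(𝔪ᵢ):κ] ord_{B_𝔪ᵢ}(f)` (Stacks
Tag 02MJ, Fulton Prop. 1.4 (b)) and hence to the compatibility of proper push-forward with rational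
equivalence (Stacks Tag 02RT/02S2, `Literature.AlgebraicGeometry.Motives.map_div_eq_div_norm`).
Everything here is proved; there are no definitions and no named facts.

## Proof (Fulton, loc. cit.)

* `ℓ(Aⁿ/PQAⁿ) = ℓ(Aⁿ/PAⁿ) + ℓ(Aⁿ/QAⁿ)` for `det P ≠ 0` (Lemma A.2.5 for injective
  maps: `0 → M/g(M) → M/fg(M) → M/f(M) → 0`), and the formula holds for diagonal matrices
  (`Aⁿ / diag(d) Aⁿ ≅ ⊕ A/dᵢA`) and for matrices invertible over `A` (both sides vanish).
* Hence the predicate "every `A`-matrix `P` with `P = aQ`, `a ∈ A ∖ 0`, satisfies the formula"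
  on `Q ∈ GL(n, K)`, `K = Frac A` (Fulton's homomorphism `h : GL(n, K) → ℤ` being zero at `Q`)
  is stable under products and holds at invertible diagonal matrices over `K` and at transvections
  (`T(p/q) = D⁻¹ T(p) D` with `T(p) ∈ SL(n, A)` and `D` diagonal); these generate `GL(n, K)`
  (Mathlib `Matrix.diagonal_transvection_induction_of_det_ne_zero`).

## Main results

* `Literature.RingTheory.OrderOfVanishing.length_quotient_range_comp`: Fulton A.2.5 (injective
  case).
* `Literature.RingTheory.OrderOfVanishing.length_quotient_range_toLin'_diagonal`: the diagonal case.
* `Literature.RingTheory.OrderOfVanishing.length_quotient_range_toLin'_eq_ord_det`: Fulton A.2.6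
  for matrices.
* `Literature.RingTheory.OrderOfVanishing.length_quotient_range_eq_ord_det`: the same for an
  endomorphism of a finite free module, with `LinearMap.det`.

## References

* [Fulton1998] W. Fulton, *Intersection Theory*, 2nd ed., Springer (1998), Appendix A.2,
  Lemmas A.2.5, A.2.6; A.3.
* [StacksProject] The Stacks Project, Algebra, Section 10.121 "Orders of vanishing", Tags 02MD,
  02MI (Lemma 10.121.7), 02MJ (Lemma 10.121.8).
-/

open Module

namespace Literature.RingTheory.OrderOfVanishing

section Comp

variable {A M : Type*} [Ring A] [AddCommGroup M] [Module A M]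

/-- For endomorphisms `f`, `g` of a module with `f` injective,
`ℓ(M / fg(M)) = ℓ(M / f(M)) + ℓ(M / g(M))`: the sequence
`0 → M/g(M) →[f] M/fg(M) → M/f(M) → 0` is exact (Fulton, *Intersection Theory*, Lemma A.2.5,
for injective endomorphisms). [cite: Fulton1998, Lemma A.2.5] -/
theorem length_quotient_range_comp (f g : M →ₗ[A] M) (hf : Function.Injective f) :
    Module.length A (M ⧸ LinearMap.range (f ∘ₗ g)) =
      Module.length A (M ⧸ LinearMap.range f) + Module.length A (M ⧸ LinearMap.range g) := by
  have hle : LinearMap.range (f ∘ₗ g) ≤ LinearMap.range f := by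
    rw [LinearMap.range_comp]; exact LinearMap.map_le_range
  have hcomap : LinearMap.range g ≤ (LinearMap.range (f ∘ₗ g)).comap f := by
    rintro _ ⟨y, rfl⟩
    exact ⟨y, rfl⟩
  let φ : (M ⧸ LinearMap.range g) →ₗ[A] (M ⧸ LinearMap.range (f ∘ₗ g)) :=
    Submodule.mapQ _ _ f hcomap
  let π : (M ⧸ LinearMap.range (f ∘ₗ g)) →ₗ[A] (M ⧸ LinearMap.range f) :=
    Submodule.factor hle
  have hφ : Function.Injective φ := by
    rw [← LinearMap.ker_eq_bot, Submodule.ker_mapQ, ← LinearMap.le_ker_iff_map,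
      Submodule.ker_mkQ]
    rintro x ⟨y, hy⟩
    exact ⟨y, hf (by simpa using hy)⟩
  have hπ : Function.Surjective π := Submodule.factor_surjective hle
  have hex : Function.Exact φ π := by
    rw [LinearMap.exact_iff, Submodule.ker_mapQ, Submodule.range_mapQ, Submodule.comap_id]
  rw [Module.length_eq_add_of_exact φ π hφ hπ hex, add_comm]

end Comp

section Basic

variable {A : Type*} [CommRing A] {ι : Type*} [Fintype ι] [DecidableEq ι]

/-- `adj(P) (P v) = det(P) v`. [folklore] -/
theorem adjugate_mulVec_mulVec (P : Matrix ι ι A) (v : ι → A) :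
    P.adjugate.mulVec (P.mulVec v) = P.det • v := by
  rw [Matrix.mulVec_mulVec, Matrix.adjugate_mul, Matrix.smul_mulVec, Matrix.one_mulVec]

/-- `P (adj(P) v) = det(P) v`. [folklore] -/
theorem mulVec_adjugate_mulVec (P : Matrix ι ι A) (v : ι → A) :
    P.mulVec (P.adjugate.mulVec v) = P.det • v := by
  rw [Matrix.mulVec_mulVec, Matrix.mul_adjugate, Matrix.smul_mulVec, Matrix.one_mulVec]

/-- A square matrix whose determinant is a non-zero-divisor acts injectively on `Aⁿ`.
[folklore] -/
theorem toLin'_injective_of_det_mem (P : Matrix ι ι A) (hP : P.det ∈ nonZeroDivisors A) :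
    Function.Injective (Matrix.toLin' P) := by
  rw [← LinearMap.ker_eq_bot, Matrix.ker_toLin'_eq_bot_iff]
  intro v hv
  have h := adjugate_mulVec_mulVec P v
  rw [hv, Matrix.mulVec_zero] at h
  funext i
  have hi := congr_fun h i
  rw [Pi.zero_apply, Pi.smul_apply, smul_eq_mul, eq_comm,
    mul_left_mem_nonZeroDivisors_eq_zero_iff hP] at hi
  exact hi

/-- `det(P) • v` lies in the image of `P`. [folklore] -/
theorem det_smul_mem_range_toLin' (P : Matrix ι ι A) (v : ι → A) :
    P.det • v ∈ LinearMap.range (Matrix.toLin' P) :=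
  ⟨P.adjugate.mulVec v, by rw [Matrix.toLin'_apply, mulVec_adjugate_mulVec]⟩

/-- A matrix with unit determinant is surjective on `Aⁿ`. [folklore] -/
theorem range_toLin'_eq_top_of_isUnit_det (P : Matrix ι ι A) (hP : IsUnit P.det) :
    LinearMap.range (Matrix.toLin' P) = ⊤ := by
  rw [eq_top_iff]
  rintro v -
  obtain ⟨u, hu⟩ := hP
  refine ⟨P.adjugate.mulVec (u⁻¹.val • v), ?_⟩
  rw [Matrix.toLin'_apply, mulVec_adjugate_mulVec, ← hu, smul_smul, Units.mul_inv, one_smul]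

/-- The image of a diagonal matrix `diag(d)` acting on `Aⁿ` is `⊕ᵢ dᵢ A`. [folklore] -/
theorem range_toLin'_diagonal (d : ι → A) :
    LinearMap.range (Matrix.toLin' (Matrix.diagonal d)) =
      Submodule.pi Set.univ (fun i ↦ (Ideal.span {d i} : Submodule A A)) := by
  ext v
  simp only [LinearMap.mem_range, Matrix.toLin'_apply, Submodule.mem_pi, Set.mem_univ,
    true_implies]
  constructor
  · rintro ⟨w, rfl⟩ i
    rw [Matrix.mulVec_diagonal]
    exact Ideal.mem_span_singleton'.mpr ⟨w i, mul_comm _ _⟩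
  · intro h
    choose w hw using fun i ↦ Ideal.mem_span_singleton'.mp (h i)
    refine ⟨w, funext fun i ↦ ?_⟩
    rw [Matrix.mulVec_diagonal, mul_comm]
    exact hw i

/-- `ℓ_A(Aⁿ / diag(d) Aⁿ) = Σᵢ ord_A(dᵢ)` (Fulton, Lemma A.2.6, diagonal case;
`ord_A(d) = ℓ_A(A/dA)`, Stacks 02MD). [cite: Fulton1998, Lemma A.2.6] -/
theorem length_quotient_range_toLin'_diagonal (d : ι → A) :
    Module.length A ((ι → A) ⧸ LinearMap.range (Matrix.toLin' (Matrix.diagonal d))) =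
      ∑ i, Ring.ord A (d i) := by
  rw [range_toLin'_diagonal,
    (Submodule.quotientPi (fun i ↦ (Ideal.span {d i} : Submodule A A))).length_eq,
    Module.length_pi_of_fintype]
  rfl

/-- `ord_A` of a product of non-zero-divisors is the sum of the orders (from Mathlib
`Ring.ord_mul`); a deliberate dot-notation extension of Mathlib's `Ring.ord` API. [folklore] -/
theorem _root_.Ring.ord_prod {κ : Type*} (s : Finset κ) (d : κ → A)
    (hd : ∀ i ∈ s, d i ∈ nonZeroDivisors A) :
    Ring.ord A (∏ i ∈ s, d i) = ∑ i ∈ s, Ring.ord A (d i) := by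
  classical
  induction s using Finset.induction_on with
  | empty => simp
  | insert a s ha ih =>
    rw [Finset.prod_insert ha, Finset.sum_insert ha,
      Ring.ord_mul _ (prod_mem fun i hi ↦ hd i (Finset.mem_insert_of_mem hi)),
      ih fun i hi ↦ hd i (Finset.mem_insert_of_mem hi)]

/-- The diagonal case of Fulton's Lemma A.2.6: `ℓ_A(Aⁿ / D Aⁿ) = ord_A(det D)` for a diagonal
matrix `D` with non-zero-divisor entries. [cite: Fulton1998, Lemma A.2.6] -/
theorem length_quotient_range_toLin'_diagonal_eq_ord_det (d : ι → A)
    (hd : ∀ i, d i ∈ nonZeroDivisors A) :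
    Module.length A ((ι → A) ⧸ LinearMap.range (Matrix.toLin' (Matrix.diagonal d))) =
      Ring.ord A (Matrix.diagonal d).det := by
  rw [length_quotient_range_toLin'_diagonal, Matrix.det_diagonal,
    Ring.ord_prod _ _ fun i _ ↦ hd i]

end Basic

section Finite

variable {A : Type*} [CommRing A] [IsNoetherianRing A] [Ring.KrullDimLE 1 A]
  {ι : Type*} [Fintype ι] [DecidableEq ι]

/-- Over a Noetherian ring of dimension `≤ 1`, a quotient of `Aⁿ` killed by a non-zero-divisor
`x` has finite length (it is a quotient of `(A/xA)ⁿ`, and `A/xA` has finite length,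
Stacks 02MC / Mathlib `isFiniteLength_quotient_span_singleton`). [folklore] -/
theorem length_quotient_ne_top_of_smul_mem (N : Submodule A (ι → A)) {x : A}
    (hx : x ∈ nonZeroDivisors A) (h : ∀ v : ι → A, x • v ∈ N) :
    Module.length A ((ι → A) ⧸ N) ≠ ⊤ := by
  have hle : LinearMap.range (Matrix.toLin' (Matrix.diagonal fun _ : ι ↦ x)) ≤ N := by
    rintro _ ⟨w, rfl⟩
    rw [Matrix.toLin'_apply]
    convert h w using 1
    funext i
    rw [Matrix.mulVec_diagonal, Pi.smul_apply, smul_eq_mul]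
  refine ne_top_of_le_ne_top ?_
    (Module.length_le_of_surjective (Submodule.factor hle) (Submodule.factor_surjective hle))
  rw [length_quotient_range_toLin'_diagonal]
  exact WithTop.sum_ne_top.mpr fun _ _ ↦ Ring.ord_ne_top hx

end Finite

/-! ### The determinant formula over a Noetherian domain of dimension `≤ 1`

Below, `Module.length A ((ι → A) ⧸ LinearMap.range (Matrix.toLin' P))` is `ℓ_A(Aⁿ / P Aⁿ)`, and the
recurring hypothesis
`∀ a P, a ≠ 0 → P.map (algebraMap A K) = algebraMap A K a • Q → ℓ_A(Aⁿ / P Aⁿ) = ord_A(det P)`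
on a matrix `Q` over `K = Frac A` says that Fulton's homomorphism `h : GL(n, K) → ℤ` vanishes at
`Q` (Lemma A.2.6, proof). -/

section Domain

variable {A : Type*} [CommRing A] [IsDomain A] [IsNoetherianRing A] [Ring.KrullDimLE 1 A]
  {ι : Type*} [Fintype ι] [DecidableEq ι]

omit [IsNoetherianRing A] [Ring.KrullDimLE 1 A] in
/-- `ℓ(Aⁿ/PQAⁿ) = ℓ(Aⁿ/PAⁿ) + ℓ(Aⁿ/QAⁿ)` when `det P ≠ 0` (Fulton Lemma A.2.5).
[cite: Fulton1998, Lemma A.2.5] -/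
theorem cokerLen_mul (P Q : Matrix ι ι A) (hP : P.det ≠ 0) :
    Module.length A ((ι → A) ⧸ LinearMap.range (Matrix.toLin' (P * Q))) =
      Module.length A ((ι → A) ⧸ LinearMap.range (Matrix.toLin' P)) +
        Module.length A ((ι → A) ⧸ LinearMap.range (Matrix.toLin' Q)) := by
  rw [Matrix.toLin'_mul]
  exact length_quotient_range_comp _ _ (toLin'_injective_of_det_mem P
    (mem_nonZeroDivisors_of_ne_zero hP))

omit [IsNoetherianRing A] [Ring.KrullDimLE 1 A] in
/-- A nonzero multiple `c • P` has `ℓ(Aⁿ / cP Aⁿ) = n · ord_A(c) + ℓ(Aⁿ / P Aⁿ)`. [folklore] -/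
theorem cokerLen_smul (c : A) (hc : c ≠ 0) (P : Matrix ι ι A) :
    Module.length A ((ι → A) ⧸ LinearMap.range (Matrix.toLin' (c • P))) =
      ∑ _i : ι, Ring.ord A c + Module.length A ((ι → A) ⧸ LinearMap.range (Matrix.toLin' P)) := by
  rw [Matrix.smul_eq_diagonal_mul P c, cokerLen_mul _ _ (by simp [Matrix.det_diagonal, hc]),
    length_quotient_range_toLin'_diagonal]

omit [IsNoetherianRing A] [Ring.KrullDimLE 1 A] in
/-- `ord_A(det(c • P)) = n · ord_A(c) + ord_A(det P)` for `c ≠ 0`. [folklore] -/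
theorem ord_det_smul (c : A) (hc : c ≠ 0) (P : Matrix ι ι A) :
    Ring.ord A (c • P).det = ∑ _i : ι, Ring.ord A c + Ring.ord A P.det := by
  rw [Matrix.det_smul, Ring.ord_mul' _ (mem_nonZeroDivisors_of_ne_zero (pow_ne_zero _ hc)),
    Ring.ord_pow (mem_nonZeroDivisors_of_ne_zero hc), Finset.sum_const, Finset.card_univ]

/-- `ℓ(Aⁿ / P Aⁿ)` is finite when `det P ≠ 0`. [folklore] -/
theorem cokerLen_ne_top (P : Matrix ι ι A) (hP : P.det ≠ 0) :
    Module.length A ((ι → A) ⧸ LinearMap.range (Matrix.toLin' P)) ≠ ⊤ :=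
  length_quotient_ne_top_of_smul_mem _ (mem_nonZeroDivisors_of_ne_zero hP)
    (det_smul_mem_range_toLin' P)

/-- The determinant formula `ℓ(Aⁿ / P Aⁿ) = ord_A(det P)` is invariant under nonzero scalars.
[folklore] -/
theorem cokerLen_eq_ord_det_smul_iff {c : A} (hc : c ≠ 0) (P : Matrix ι ι A) :
    Module.length A ((ι → A) ⧸ LinearMap.range (Matrix.toLin' (c • P))) = Ring.ord A (c • P).det ↔
      Module.length A ((ι → A) ⧸ LinearMap.range (Matrix.toLin' P)) = Ring.ord A P.det := by
  rw [cokerLen_smul c hc, ord_det_smul c hc, add_comm (∑ _i : ι, Ring.ord A c),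
    add_comm (∑ _i : ι, Ring.ord A c)]
  exact (ENat.add_left_injective_of_ne_top
    (WithTop.sum_ne_top.mpr fun _ _ ↦ Ring.ord_ne_top (mem_nonZeroDivisors_of_ne_zero hc))).eq_iff

omit [IsNoetherianRing A] [Ring.KrullDimLE 1 A] in
/-- The determinant formula is stable under products. [folklore] -/
theorem cokerLen_mul_eq_ord_det {P Q : Matrix ι ι A} (hP : P.det ≠ 0) (hQ : Q.det ≠ 0)
    (h₁ : Module.length A ((ι → A) ⧸ LinearMap.range (Matrix.toLin' P)) = Ring.ord A P.det)
    (h₂ : Module.length A ((ι → A) ⧸ LinearMap.range (Matrix.toLin' Q)) = Ring.ord A Q.det) :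
    Module.length A ((ι → A) ⧸ LinearMap.range (Matrix.toLin' (P * Q))) =
      Ring.ord A (P * Q).det := by
  rw [cokerLen_mul P Q hP, Matrix.det_mul, Ring.ord_mul _ (mem_nonZeroDivisors_of_ne_zero hQ),
    h₁, h₂]

omit [IsDomain A] [IsNoetherianRing A] [Ring.KrullDimLE 1 A] in
/-- The determinant formula for matrices invertible over `A`: both sides vanish. [folklore] -/
theorem cokerLen_eq_ord_det_of_isUnit {P : Matrix ι ι A} (hP : IsUnit P.det) :
    Module.length A ((ι → A) ⧸ LinearMap.range (Matrix.toLin' P)) = Ring.ord A P.det := by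
  rw [range_toLin'_eq_top_of_isUnit_det P hP, Ring.ord_of_isUnit hP]
  exact Module.length_eq_zero_iff.mpr (Submodule.Quotient.subsingleton_iff.mpr rfl)

end Domain

/-! ### Passage to the fraction field: the determinant formula for all matrices -/

section Fraction

variable {A : Type*} [CommRing A] [IsDomain A] [IsNoetherianRing A] [Ring.KrullDimLE 1 A]
  {K : Type*} [Field K] [Algebra A K] [IsFractionRing A K]
  {ι : Type*} [Fintype ι] [DecidableEq ι]

omit [IsNoetherianRing A] [Ring.KrullDimLE 1 A] [DecidableEq ι] in
/-- Every matrix over `K = Frac A` has a common denominator. [folklore] -/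
theorem exists_map_eq_smul (Q : Matrix ι ι K) :
    ∃ a : A, a ≠ 0 ∧ ∃ P : Matrix ι ι A, P.map (algebraMap A K) = algebraMap A K a • Q := by
  obtain ⟨b, hb⟩ := IsLocalization.exist_integer_multiples (nonZeroDivisors A)
    (Finset.univ : Finset (ι × ι)) fun ij ↦ Q ij.1 ij.2
  choose p hp using fun ij : ι × ι ↦ hb ij (Finset.mem_univ ij)
  refine ⟨b, nonZeroDivisors.ne_zero b.2, Matrix.of fun i j ↦ p (i, j), ?_⟩
  ext i j
  rw [Matrix.map_apply, Matrix.of_apply, hp (i, j), Matrix.smul_apply, Algebra.smul_def]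
  rfl

omit [IsDomain A] [IsNoetherianRing A] [Ring.KrullDimLE 1 A] in
/-- If `P = a Q` over `K` with `a ≠ 0` and `det Q ≠ 0` then `det P ≠ 0`. [folklore] -/
theorem det_ne_zero_of_map_eq_smul {Q : Matrix ι ι K} (hQ : Q.det ≠ 0) {a : A} (ha : a ≠ 0)
    {P : Matrix ι ι A} (hP : P.map (algebraMap A K) = algebraMap A K a • Q) : P.det ≠ 0 := by
  intro h
  have h' : algebraMap A K P.det = (algebraMap A K a • Q).det := by
    rw [RingHom.map_det, RingHom.mapMatrix_apply, hP]
  rw [h, map_zero, Matrix.det_smul] at h'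
  exact mul_ne_zero (pow_ne_zero _ ((map_ne_zero_iff _ (IsFractionRing.injective A K)).mpr ha))
    hQ h'.symm

omit [IsNoetherianRing A] [Ring.KrullDimLE 1 A] [IsDomain A] [IsFractionRing A K] [Fintype ι]
  [DecidableEq ι] in
/-- `(c • P) ↦ (algebraMap c) • P.map` under `Matrix.map (algebraMap A K)`. [folklore] -/
theorem map_smul_algebraMap (c : A) (P : Matrix ι ι A) :
    (c • P).map (algebraMap A K) = algebraMap A K c • P.map (algebraMap A K) :=
  Matrix.map_smul' _ _ _ (map_mul _)

/-- The determinant formula is stable under products: Fulton's `h` is a homomorphism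
(Lemma A.2.6, proof). [cite: Fulton1998, Lemma A.2.6] -/
theorem detFormulaAt_mul {Q Q' : Matrix ι ι K} (hQ : Q.det ≠ 0) (hQ' : Q'.det ≠ 0)
    (h : ∀ (a : A) (P : Matrix ι ι A), a ≠ 0 → P.map (algebraMap A K) = algebraMap A K a • Q →
      Module.length A ((ι → A) ⧸ LinearMap.range (Matrix.toLin' P)) = Ring.ord A P.det)
    (h' : ∀ (a : A) (P : Matrix ι ι A), a ≠ 0 → P.map (algebraMap A K) = algebraMap A K a • Q' →
      Module.length A ((ι → A) ⧸ LinearMap.range (Matrix.toLin' P)) = Ring.ord A P.det) :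
    ∀ (a : A) (P : Matrix ι ι A), a ≠ 0 → P.map (algebraMap A K) = algebraMap A K a • (Q * Q') →
      Module.length A ((ι → A) ⧸ LinearMap.range (Matrix.toLin' P)) = Ring.ord A P.det := by
  intro a P ha hP
  obtain ⟨b, hb, P₁, hP₁⟩ := exists_map_eq_smul (A := A) Q
  obtain ⟨b', hb', P₂, hP₂⟩ := exists_map_eq_smul (A := A) Q'
  have h₁ : P₁.det ≠ 0 := det_ne_zero_of_map_eq_smul hQ hb hP₁
  have h₂ : P₂.det ≠ 0 := det_ne_zero_of_map_eq_smul hQ' hb' hP₂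
  have key : (b * b') • P = a • (P₁ * P₂) := by
    apply Matrix.map_injective (IsFractionRing.injective A K)
    change ((b * b') • P).map (algebraMap A K) = (a • (P₁ * P₂)).map (algebraMap A K)
    rw [map_smul_algebraMap, map_smul_algebraMap, hP, Matrix.map_mul, hP₁, hP₂, map_mul,
      Matrix.smul_mul, Matrix.mul_smul, smul_smul, smul_smul, smul_smul, mul_comm, mul_assoc]
  have hprod : Module.length A ((ι → A) ⧸ LinearMap.range (Matrix.toLin' (a • (P₁ * P₂)))) =
      Ring.ord A (a • (P₁ * P₂)).det :=
    (cokerLen_eq_ord_det_smul_iff ha (P₁ * P₂)).mpr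
      (cokerLen_mul_eq_ord_det h₁ h₂ (h b P₁ hb hP₁) (h' b' P₂ hb' hP₂))
  rw [← key] at hprod
  exact (cokerLen_eq_ord_det_smul_iff (mul_ne_zero hb hb') P).mp hprod

/-- The determinant formula at (the image of) an `A`-matrix satisfying it. [folklore] -/
theorem detFormulaAt_map {U : Matrix ι ι A}
    (h : Module.length A ((ι → A) ⧸ LinearMap.range (Matrix.toLin' U)) = Ring.ord A U.det) :
    ∀ (a : A) (P : Matrix ι ι A), a ≠ 0 →
      P.map (algebraMap A K) = algebraMap A K a • U.map (algebraMap A K) →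
      Module.length A ((ι → A) ⧸ LinearMap.range (Matrix.toLin' P)) = Ring.ord A P.det := by
  intro a P ha hP
  rw [← map_smul_algebraMap] at hP
  have hP' : P = a • U := Matrix.map_injective (IsFractionRing.injective A K) hP
  rw [hP']
  exact (cokerLen_eq_ord_det_smul_iff ha U).mpr h

omit [IsNoetherianRing A] [Ring.KrullDimLE 1 A] in
/-- The determinant formula at invertible diagonal matrices over `K` (an `A`-matrix which is
`a` times a diagonal matrix is diagonal). [cite: Fulton1998, Lemma A.2.6] -/
theorem detFormulaAt_diagonal (d : ι → K) (hd : (Matrix.diagonal d).det ≠ 0) :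
    ∀ (a : A) (P : Matrix ι ι A), a ≠ 0 →
      P.map (algebraMap A K) = algebraMap A K a • Matrix.diagonal d →
      Module.length A ((ι → A) ⧸ LinearMap.range (Matrix.toLin' P)) = Ring.ord A P.det := by
  intro a P ha hP
  have hdiag : P = Matrix.diagonal fun i ↦ P i i := by
    ext i j
    by_cases hij : i = j
    · subst hij; rw [Matrix.diagonal_apply_eq]
    · rw [Matrix.diagonal_apply_ne _ hij]
      apply IsFractionRing.injective A K
      have hPij := congr_fun (congr_fun hP i) j
      rw [Matrix.map_apply, Matrix.smul_apply, Matrix.diagonal_apply_ne _ hij, smul_zero] at hPij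
      rw [hPij, map_zero]
  have hdet : P.det ≠ 0 := det_ne_zero_of_map_eq_smul hd ha hP
  rw [hdiag] at hdet ⊢
  refine length_quotient_range_toLin'_diagonal_eq_ord_det _ fun i ↦
    mem_nonZeroDivisors_of_ne_zero fun hi ↦ hdet ?_
  rw [Matrix.det_diagonal]
  exact Finset.prod_eq_zero (Finset.mem_univ i) hi

omit [IsDomain A] [IsNoetherianRing A] [Ring.KrullDimLE 1 A] [IsFractionRing A K] [Fintype ι] in
/-- Transvections map to transvections. [folklore] -/
theorem map_transvection (i j : ι) (p : A) :
    (Matrix.transvection i j p).map (algebraMap A K) =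
      Matrix.transvection i j (algebraMap A K p) := by
  ext x y
  simp only [Matrix.transvection, Matrix.map_apply, Matrix.add_apply, map_add]
  congr 1
  · by_cases h : x = y
    · subst h; simp
    · simp [Matrix.one_apply_ne h]
  · by_cases h : i = x ∧ j = y
    · obtain ⟨rfl, rfl⟩ := h; simp
    · rw [Matrix.single_apply_of_ne _ _ _ _ _ h, Matrix.single_apply_of_ne _ _ _ _ _ h, map_zero]

omit [IsDomain A] [IsNoetherianRing A] [Ring.KrullDimLE 1 A] [Algebra A K]
  [IsFractionRing A K] in
/-- Conjugating a transvection by a diagonal matrix rescales its off-diagonal entry: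
`diag(1,…,q⁻¹,…,1) · T_{ij}(p) · diag(1,…,q,…,1) = T_{ij}(p/q)` (the `q` in position `i`).
[folklore] -/
theorem diagonal_mul_transvection_mul_diagonal {i j : ι} (hij : i ≠ j) (p q : K) (hq : q ≠ 0) :
    Matrix.diagonal (Function.update 1 i q⁻¹) * Matrix.transvection i j p *
        Matrix.diagonal (Function.update 1 i q) = Matrix.transvection i j (q⁻¹ * p) := by
  ext x y
  rw [Matrix.mul_diagonal, Matrix.diagonal_mul]
  simp only [Matrix.transvection, Matrix.add_apply, Function.update_apply, Pi.one_apply]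
  by_cases hxy : x = y
  · subst hxy
    have hs : Matrix.single i j p x x = 0 :=
      Matrix.single_apply_of_ne _ _ _ _ _ fun h ↦ hij (h.1.trans h.2.symm)
    have hs' : Matrix.single i j (q⁻¹ * p) x x = 0 :=
      Matrix.single_apply_of_ne _ _ _ _ _ fun h ↦ hij (h.1.trans h.2.symm)
    rw [hs, hs', Matrix.one_apply_eq, add_zero, mul_one]
    split_ifs with h
    · rw [inv_mul_cancel₀ hq]
    · rw [mul_one]
  · rw [Matrix.one_apply_ne hxy, zero_add, zero_add]
    by_cases h : i = x ∧ j = y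
    · obtain ⟨rfl, rfl⟩ := h
      rw [Matrix.single_apply_same, Matrix.single_apply_same, if_pos rfl, if_neg hij.symm, mul_one]
    · rw [Matrix.single_apply_of_ne _ _ _ _ _ h, Matrix.single_apply_of_ne _ _ _ _ _ h, mul_zero,
        zero_mul]

/-- The determinant formula at transvections over `K`: `h` vanishes on them (Fulton,
Lemma A.2.6, proof; here via `T(p/q) = D⁻¹ T(p) D` with `T(p)` invertible over `A`).
[cite: Fulton1998, Lemma A.2.6] -/
theorem detFormulaAt_transvection (t : Matrix.TransvectionStruct ι K) :
    ∀ (a : A) (P : Matrix ι ι A), a ≠ 0 →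
      P.map (algebraMap A K) = algebraMap A K a • t.toMatrix →
      Module.length A ((ι → A) ⧸ LinearMap.range (Matrix.toLin' P)) = Ring.ord A P.det := by
  obtain ⟨i, j, hij, c⟩ := t
  obtain ⟨p, q, hq, rfl⟩ := IsFractionRing.div_surjective (A := A) c
  have hq' : algebraMap A K q ≠ 0 :=
    (map_ne_zero_iff _ (IsFractionRing.injective A K)).mpr (nonZeroDivisors.ne_zero hq)
  rw [Matrix.TransvectionStruct.toMatrix_mk, div_eq_inv_mul,
    ← diagonal_mul_transvection_mul_diagonal hij _ _ hq', ← map_transvection]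
  have hd₁ : (Matrix.diagonal (Function.update (1 : ι → K) i (algebraMap A K q)⁻¹)).det ≠ 0 := by
    rw [Matrix.det_diagonal]
    exact Finset.prod_ne_zero_iff.mpr fun x _ ↦ by
      rw [Function.update_apply]; split_ifs <;> simp [hq']
  have hd₂ : (Matrix.diagonal (Function.update (1 : ι → K) i (algebraMap A K q))).det ≠ 0 := by
    rw [Matrix.det_diagonal]
    exact Finset.prod_ne_zero_iff.mpr fun x _ ↦ by
      rw [Function.update_apply]; split_ifs <;> simp [hq']
  have hT : ((Matrix.transvection i j p).map (algebraMap A K)).det ≠ 0 := by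
    rw [map_transvection, Matrix.det_transvection_of_ne _ _ hij]; exact one_ne_zero
  refine detFormulaAt_mul (by rw [Matrix.det_mul]; exact mul_ne_zero hd₁ hT) hd₂
    (detFormulaAt_mul hd₁ hT (detFormulaAt_diagonal _ hd₁) (detFormulaAt_map ?_))
    (detFormulaAt_diagonal _ hd₂)
  exact cokerLen_eq_ord_det_of_isUnit (by
    rw [Matrix.det_transvection_of_ne _ _ hij]; exact isUnit_one)

/-- **Fulton's Lemma A.2.6** (for one-dimensional Noetherian domains; equivalently Stacks,
Algebra, Lemma 10.121.7 = Tag 02MI for the lattice `M = Aⁿ`, where `d(Aⁿ, P Aⁿ) = ℓ(Aⁿ/PAⁿ)`):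
for a square matrix `P` over a Noetherian domain `A` of Krull dimension `≤ 1` with `det P ≠ 0`,
`ℓ_A(Aⁿ / P Aⁿ) = ord_A(det P) = ℓ_A(A / det(P) A)`.
Proof as printed: the defect `h` is a homomorphism on `GL(n, K)`, `K = Frac A`, vanishing on
diagonal matrices and transvections, which generate (Mathlib
`Matrix.diagonal_transvection_induction_of_det_ne_zero`). [cite: Fulton1998, Lemma A.2.6] -/
theorem length_quotient_range_toLin'_eq_ord_det (P : Matrix ι ι A) (hP : P.det ≠ 0) :
    Module.length A ((ι → A) ⧸ LinearMap.range (Matrix.toLin' P)) = Ring.ord A P.det := by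
  let K := FractionRing A
  have hQ : (P.map (algebraMap A K)).det ≠ 0 := by
    rw [← RingHom.mapMatrix_apply, ← RingHom.map_det]
    exact (map_ne_zero_iff _ (IsFractionRing.injective A K)).mpr hP
  have hgood : ∀ (a : A) (P' : Matrix ι ι A), a ≠ 0 →
      P'.map (algebraMap A K) = algebraMap A K a • P.map (algebraMap A K) →
      Module.length A ((ι → A) ⧸ LinearMap.range (Matrix.toLin' P')) = Ring.ord A P'.det := by
    refine Matrix.diagonal_transvection_induction_of_det_ne_zero
      (fun Q : Matrix ι ι K ↦ ∀ (a : A) (P' : Matrix ι ι A), a ≠ 0 →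
        P'.map (algebraMap A K) = algebraMap A K a • Q →
        Module.length A ((ι → A) ⧸ LinearMap.range (Matrix.toLin' P')) = Ring.ord A P'.det)
      (P.map (algebraMap A K)) hQ (fun D hD ↦ detFormulaAt_diagonal D hD)
      (fun t ↦ detFormulaAt_transvection t) ?_
    intro Q Q' hQ hQ' h h'
    exact detFormulaAt_mul hQ hQ' h h'
  exact hgood 1 P one_ne_zero (by rw [map_one, one_smul])

end Fraction

/-! ### Basis-free form: endomorphisms of finite free modules -/

section Free

variable {A : Type*} [CommRing A] [IsDomain A] [IsNoetherianRing A] [Ring.KrullDimLE 1 A]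
  {M : Type*} [AddCommGroup M] [Module A M] [Module.Free A M] [Module.Finite A M]

/-- **Fulton's Lemma A.2.6**, basis-free: for an endomorphism `f` of a finite free module over a
Noetherian domain of dimension `≤ 1` with `det f ≠ 0`, `ℓ_A(M / f(M)) = ord_A(det f)`.
[cite: Fulton1998, Lemma A.2.6] -/
theorem length_quotient_range_eq_ord_det (f : M →ₗ[A] M) (hf : LinearMap.det f ≠ 0) :
    Module.length A (M ⧸ LinearMap.range f) = Ring.ord A (LinearMap.det f) := by
  classical
  let b := Module.Free.chooseBasis A M
  let e : M ≃ₗ[A] (Module.Free.ChooseBasisIndex A M → A) := b.equivFun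
  let g : (Module.Free.ChooseBasisIndex A M → A) →ₗ[A] (Module.Free.ChooseBasisIndex A M → A) :=
    e.toLinearMap ∘ₗ f ∘ₗ e.symm.toLinearMap
  have hdet : LinearMap.det g = LinearMap.det f := LinearMap.det_conj f e
  have hrange : Submodule.map e.toLinearMap (LinearMap.range f) = LinearMap.range g := by
    change _ = LinearMap.range (e.toLinearMap ∘ₗ f ∘ₗ e.symm.toLinearMap)
    rw [← LinearMap.comp_assoc, LinearMap.range_comp_of_range_eq_top _ e.symm.range,
      LinearMap.range_comp]
  rw [(Submodule.Quotient.equiv _ _ e hrange).length_eq, ← hdet, ← Matrix.toLin'_toMatrix' g,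
    LinearMap.det_toLin']
  refine length_quotient_range_toLin'_eq_ord_det _ ?_
  rwa [← LinearMap.det_toLin', Matrix.toLin'_toMatrix', hdet]

end Free

end Literature.RingTheory.OrderOfVanishing
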